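import Summits.CriticalPhenomena.PercolationContinuityZ3.Theorems.PercNearOneGluingNoHeavyLowerTailTformStarTransfer
import HarnessLib

/-!
# `NoHeavyLowerTail` (stmt-CriticalPhenomena-4575) — tools for the one-Steiner-gate transfer: clusters on the star `σ_{s}`

Support file (prover `prim-hp-5`, hull-port cell, T-form calculus, gen 3; `--supports stmt-CriticalPhenomena-4575`).
No definitions, no named facts, no sorries.  Notation of `…TformStarTransfer`: observer `o`, `K = G − o` read on
`ω ∩ {e | o ∉ e}`, star events `σ_B` of `o` (`Literature….starEvent`).

On the star `σ_{s}` the observer `o` is a pendant vertex of `s`; hence open paths between vertices `≠ o` can be rerouted to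
avoid `o`, the relays joined to any `x ≠ o` are the relays `K`-joined to `x`, and the relays joined to `o` are the relays
`K`-joined to `s`.  On the empty star `σ_∅` the observer is isolated.  These pointwise facts feed the per-star bookkeeping of
`Theorems.tform_of_reference_oneSteinerGate` (file `…TformOneSteinerGate`).

* `CutObserver.reach_avoid_of_star_singleton` — walk induction through the pendant vertex;
* `CutObserver.filter_eq_avoid_of_star_singleton`, `CutObserver.filter_obs_eq_of_star_singleton`,
  `CutObserver.filter_eq_avoid_of_star_empty` — the resulting `Finset.filter` identities.
-/

noncomputable section

namespace Summit.CriticalPhenomena.PercolationContinuityZ3.Theorems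

open MeasureTheory Set Literature.Probability.LatticeModels Literature.Probability.Percolation
open scoped Classical BigOperators

variable {n : ℕ}

namespace CutObserver

/-- **A pendant observer does not shorten paths.**  On the star `σ_{s}` of `o` (the pair `o–s` is the only open pair at `o`),
if two vertices `x, z ≠ o` are joined by an open path, they are joined by an open path using no pair at `o`. [folklore] -/
theorem reach_avoid_of_star_singleton {ω : BondConfig (Fin n)} {o s : Fin n}
    (hσ : ω ∈ starEvent o ({s} : Set (Fin n))) {x z : Fin n} (hxo : x ≠ o) (hzo : z ≠ o)
    (hxz : (openGraph ω).Reachable x z) : (openGraph (ω ∩ {e | o ∉ e})).Reachable x z := by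
  -- every open pair at `o` is the pair `o–s`
  have hat : ∀ u, (openGraph ω).Adj o u → u = s := by
    intro u hu
    rw [openGraph_adj] at hu
    have h := ((mem_starEvent_iff o ({s} : Set (Fin n)) ω).1 hσ u hu.2.symm).1 hu.1
    simpa using h
  suffices key : ∀ (k : ℕ) (x z : Fin n) (p : (openGraph ω).Walk x z), p.length ≤ k → x ≠ o → z ≠ o →
      (openGraph (ω ∩ {e | o ∉ e})).Reachable x z by
    obtain ⟨p⟩ := hxz
    exact key p.length x z p le_rfl hxo hzo
  intro k
  induction k with
  | zero =>
    intro x z p hp _ _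
    have h0 : p.length = 0 := Nat.le_zero.1 hp
    have hxz' : x = z := SimpleGraph.Walk.eq_of_length_eq_zero h0
    subst hxz'
    exact SimpleGraph.Reachable.refl _
  | succ k ih =>
    intro x z p hp hxo hzo
    cases p with
    | nil => exact SimpleGraph.Reachable.refl _
    | cons h q =>
      rename_i y
      by_cases hy : y = o
      · -- the walk steps into `o`: it came from `s` and must leave through `s`
        have hx : x = s := hat x (hy ▸ h).symm
        cases q with
        | nil => exact absurd hy hzo
        | cons h' q' =>
          rename_i y'
          have hy' : y' = s := hat y' (hy ▸ h')
          have hlen : q'.length ≤ k := by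
            simp only [SimpleGraph.Walk.length_cons] at hp
            omega
          have hso : s ≠ o := hx ▸ hxo
          have hy'o : y' ≠ o := by rw [hy']; exact hso
          rw [hx, ← hy']
          exact ih y' z q' hlen hy'o hzo
      · -- the first pair avoids `o`
        have hadj : (openGraph (ω ∩ {e | o ∉ e})).Adj x y := by
          rw [openGraph_adj] at h ⊢
          refine ⟨⟨h.1, ?_⟩, h.2⟩
          show o ∉ s(x, y)
          rw [Sym2.mem_iff, not_or]
          exact ⟨fun h' => hxo h'.symm, fun h' => hy h'.symm⟩
        have hlen : q.length ≤ k := by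
          simp only [SimpleGraph.Walk.length_cons] at hp
          omega
        exact hadj.reachable.trans (ih y z q hlen hy hzo)

/-- On the star `σ_{s}`, the relays joined to a vertex `x ≠ o` are the relays joined to `x` avoiding `o`
(`o ∉ A`). [folklore] -/
theorem filter_eq_avoid_of_star_singleton (A : Finset (Fin n)) {ω : BondConfig (Fin n)} {o s x : Fin n}
    (hσ : ω ∈ starEvent o ({s} : Set (Fin n))) (hoA : o ∉ A) (hxo : x ≠ o) :
    (A.filter fun z => ω ∈ openConn x z) = (A.filter fun z => (openGraph (ω ∩ {e | o ∉ e})).Reachable x z) := by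
  refine Finset.filter_congr fun z hz => ⟨fun h => ?_, fun h => reachable_mono inter_subset_left h⟩
  have hzo : z ≠ o := fun h' => hoA (h' ▸ hz)
  exact reach_avoid_of_star_singleton hσ hxo hzo h

/-- On the star `σ_{s}` (`s ≠ o`, `o ∉ A`), the relays joined to `o` are the relays joined to `s` avoiding `o`. [folklore] -/
theorem filter_obs_eq_of_star_singleton (A : Finset (Fin n)) {ω : BondConfig (Fin n)} {o s : Fin n}
    (hσ : ω ∈ starEvent o ({s} : Set (Fin n))) (hoA : o ∉ A) (hso : s ≠ o) :
    (A.filter fun z => ω ∈ openConn o z) = (A.filter fun z => (openGraph (ω ∩ {e | o ∉ e})).Reachable s z) := by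
  refine Finset.filter_congr fun z hz => ⟨fun h => ?_, fun h => ?_⟩
  · have hzo : z ≠ o := fun h' => hoA (h' ▸ hz)
    obtain ⟨y, hy, hyz⟩ := exists_avoid_of_reachable_star hσ hzo h
    rw [Set.mem_singleton_iff] at hy
    exact hy ▸ hyz
  · exact reachable_of_mem_star hσ hso (Set.mem_singleton s) h

/-- On the empty star `σ_∅` (`o` isolated), the relays joined to a vertex `x ≠ o` are the relays joined to `x`
avoiding `o`. [folklore] -/
theorem filter_eq_avoid_of_star_empty (A : Finset (Fin n)) {ω : BondConfig (Fin n)} {o x : Fin n}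
    (hσ : ω ∈ starEvent o (∅ : Set (Fin n))) (hxo : x ≠ o) :
    (A.filter fun z => ω ∈ openConn x z) = (A.filter fun z => (openGraph (ω ∩ {e | o ∉ e})).Reachable x z) := by
  refine Finset.filter_congr fun z _ => ⟨fun h => ?_, fun h => reachable_mono inter_subset_left h⟩
  have hxo' : ¬ (openGraph ω).Reachable x o := fun h' => KNPreFKG.not_reachable_of_mem_starEvent_empty hσ hxo h'.symm
  exact reachable_avoiding_of_not_reachable hxo' h

end CutObserver

end Summit.CriticalPhenomena.PercolationContinuityZ3.Theorems

end
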